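import Summits.QuantumFields.YangMills.Theorems.BalabanLadderROTWardShape
import Summits.QuantumFields.YangMills.Theorems.BalabanLadderROTWardShapeCubicProfile
import Summits.QuantumFields.YangMills.Theorems.BalabanLadderROTWardWeightTaylor
import HarnessLib

/-!
# Crux `ROT` (stmt-QuantumFields-20042), infinitesimal Ward route (lane B) — XI: the SHAPE BARRIER with all lattice symmetries (hypercubic-invariant witness)

Helper file (`--supports stmt-QuantumFields-20042`, lane `ym-rot-20042-p2`).  Strengthening of `…WardShape.lean`
(`exists_momentBoundsShape_not_angularWardShape`): the witness family can be taken with ALL the kinematic structure of the centred torus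
moments of `tr F²` that the binder and the lattice symmetries see.

* §1 the family `W β L 2 (x₀,x₁) = a(β)⁸ h_c(a(β)(x₀ − x₁))`, `h_c(z) = η(‖z‖²) Σ_μ (z^μ)⁴` (`Wgen hcFun`): only the two-point weight
  non-zero, TRANSLATION invariant (`Wgen_translate`), HYPERCUBIC invariant — every permutation and every sign change of the axes
  (`Wgen_hcFun_hypercubic`) —, `|W| ≤ 4 a⁸` (`abs_Wgen_le`), and it satisfies every MomentBounds-shape inequality with `C = 2`
  (`momentBoundsShape_Wgen`);
* §2 along `β_k = k`, `L_k = (k+24)²` its angular insertion at the germ-class test function `T_{q,s}` (`q = ∂_θ h_c`) converges to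
  `∫ q(z)² χ_s(z) ψ(w₁) dw > 0` (`tendsto_angularSum_Wgen_hcFun`: weight-side Taylor expansion `abs_latAngMom_profile_sub_le`, Riemann count,
  the tree's `tendsto_riemann_sum` — no summation by parts needed in this direction);
* §3 **`exists_hypercubic_momentBoundsShape_not_angularWardShape`**.

READING: `MomentBounds6` + translation invariance + the full hypercubic symmetry of the lattice moments do not imply the Ward form of
the registered stub (`KingAngular ⟺ KingLimit`) by any estimate «insertion ≤ ω(a)·norms», ω → 0: rotation invariance of the UV limit
points is invisible to hyperscaling sizes and lattice symmetries (the `ℓ = 4` cubic harmonic `Σ z_μ⁴` passes both).  A proof must use the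
dynamics of the Wilson measure.  HONEST FRAMING: a barrier for one proof strategy of an OPEN crux; it says nothing about the truth of
`ROT`, E1, or the mass gap.  No fact, no sorry.
-/

set_option autoImplicit false

noncomputable section

open scoped SchwartzMap BigOperators RealInnerProductSpace ContDiff
open MeasureTheory Filter Topology Metric
open Literature.MathematicalPhysics.QuantumFieldTheory Literature.MathematicalPhysics.QuantumLattice
open Literature.MathematicalPhysics.AQFT
open Literature.Probability.LatticeModels (box Site mem_box)
open Summit.QuantumFields.YangMills.Cruxes.OSLegsFromFemtoAndGap.DlrCollarTransfer (MomentBounds)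
open Summit.QuantumFields.YangMills.Cruxes.OSLegsAtWeakCouplingC.Sketch (Separated SmallDiam)
open Summit.QuantumFields.YangMills.Cruxes.OSLegsAtWeakCouplingC.Y2Bridge (LatticeRotWard)
open Summit.QuantumFields.YangMills.Cruxes.OSLegsAtWeakCouplingC.Y2Bridge.King (KingClass)
open Summit.QuantumFields.YangMills.Theorems.OSLegsFromFemtoAndGap (torusMoment mul_norm_le_norm_smul_siteToE
  norm_smul_siteToE_sub_le abs_coord_le_norm_siteToE siteToE_sub)
open Summit.QuantumFields.YangMills.Theorems.NPointIsotropy.Negative (E4)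

namespace Summit.QuantumFields.YangMills.Theorems.ROT.Ward

/-! ## The hypercubic-invariant witness and its barrier -/

section CubicWitness

/-- The weight family built on a one-slot profile `h`: `W β L 2 (x₀,x₁) = a(β)⁸ h(a(β)(x₀ − x₁))`, all other `n` zero. -/
def Wgen (h : E4 → ℝ) (β : ℝ) (_L : ℕ) (n : ℕ) (x : Fin n → Site 4) : ℝ :=
  if hn : n = 2 then aW β ^ 8 * h (scaleSite (aW β) x ⟨0, by omega⟩ - scaleSite (aW β) x ⟨1, by omega⟩) else 0

/-- The two-point weight of the family. -/
theorem Wgen_two (h : E4 → ℝ) (β : ℝ) (L : ℕ) (x : Fin 2 → Site 4) :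
    Wgen h β L 2 x = aW β ^ 8 * h (scaleSite (aW β) x 0 - scaleSite (aW β) x 1) := by
  simp only [Wgen, dif_pos]
  rfl

/-- All other weights of the family vanish. -/
theorem Wgen_of_ne_two (h : E4 → ℝ) (β : ℝ) (L : ℕ) {n : ℕ} (hn : n ≠ 2) (x : Fin n → Site 4) : Wgen h β L n x = 0 := by
  simp [Wgen, hn]

/-- Translation invariance of the family. -/
theorem Wgen_translate (h : E4 → ℝ) (β : ℝ) (L : ℕ) (x : Fin 2 → Site 4) (t : Site 4) :
    Wgen h β L 2 (fun i => x i + t) = Wgen h β L 2 x := by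
  rw [Wgen_two, Wgen_two]
  congr 2
  ext ν
  simp only [scaleSite, PiLp.sub_apply, PiLp.smul_apply, siteToE_apply, Pi.add_apply, smul_eq_mul]
  push_cast
  ring

/-- **Hypercubic invariance of the family built on `h_c`**: for every permutation `σ` of the axes and signs `ε_μ ∈ {±1}`,
`W β L 2 ((ε_μ xᵢ^{σμ})_{i,μ}) = W β L 2 x`. -/
theorem Wgen_hcFun_hypercubic (β : ℝ) (L : ℕ) (σ : Equiv.Perm (Fin 4)) (ε : Fin 4 → ℤ) (hε : ∀ μ, ε μ = 1 ∨ ε μ = -1)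
    (x : Fin 2 → Site 4) : Wgen hcFun β L 2 (fun i μ => ε μ * x i (σ μ)) = Wgen hcFun β L 2 x := by
  rw [Wgen_two, Wgen_two]
  have hε' : ∀ μ, (ε μ : ℝ) = 1 ∨ (ε μ : ℝ) = -1 := fun μ => by
    rcases hε μ with h | h <;> simp [h]
  have key : scaleSite (aW β) (fun i μ => ε μ * x i (σ μ)) 0 - scaleSite (aW β) (fun i μ => ε μ * x i (σ μ)) 1 =
      WithLp.toLp 2 (fun μ => (ε μ : ℝ) * (scaleSite (aW β) x 0 - scaleSite (aW β) x 1) (σ μ)) := by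
    ext ν
    simp only [scaleSite, PiLp.sub_apply, PiLp.smul_apply, siteToE_apply, smul_eq_mul]
    push_cast
    ring
  rw [key, hcFun_hypercubic σ (fun μ => (ε μ : ℝ)) hε']

/-- Pointwise hyperscaling of the family: `|W β L n x| ≤ B a(β)⁸` when `|h| ≤ B`. -/
theorem abs_Wgen_le (h : E4 → ℝ) {B : ℝ} (hB : ∀ z, |h z| ≤ B) (β : ℝ) (L : ℕ) {n : ℕ} (x : Fin n → Site 4) :
    |Wgen h β L n x| ≤ B * aW β ^ 8 := by
  have hB0 : 0 ≤ B := (abs_nonneg _).trans (hB 0)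
  by_cases hn : n = 2
  · subst hn
    rw [Wgen_two, abs_mul, abs_of_nonneg (by positivity : 0 ≤ aW β ^ 8)]
    nlinarith [hB (scaleSite (aW β) x 0 - scaleSite (aW β) x 1), pow_pos (aW_pos β) 8]
  · rw [Wgen_of_ne_two h β L hn, abs_zero]; positivity

/-- **The family obeys every MomentBounds-shape inequality** (constant `C = 2`) as soon as `|h| ≤ 4` and `h` vanishes outside the ball
of radius `2`: at a torus-separated pair the separation forces `R a ≤ 1`. -/
theorem momentBoundsShape_Wgen (h : E4 → ℝ) (hB : ∀ z, |h z| ≤ 4) (hsupp : ∀ z : E4, 2 ≤ ‖z‖ → h z = 0) :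
    MomentBoundsShape aW (Wgen h) := by
  refine ⟨2, 0, 1, one_pos, by norm_num, ?_⟩
  intro β _ L n x R hR1 _ _ hsep
  have hRpos : (0 : ℝ) < R := by exact_mod_cast hR1
  by_cases hn : n = 2
  · subst hn
    rw [Wgen_two]
    set a := aW β with ha_def
    have ha : 0 < a := aW_pos β
    set z : E4 := scaleSite a x 0 - scaleSite a x 1 with hz_def
    by_cases hz : h z = 0
    · rw [hz, mul_zero, abs_zero]; positivity
    have hz2 : ‖z‖ < 2 := by
      by_contra h'
      exact hz (hsupp z (not_lt.1 h'))
    obtain ⟨k, hk⟩ := hsep 0 1 (by decide)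
    have h1 : |((((x 0 k - x 1 k : ℤ) : ZMod (2 * L + 1))).valMinAbs : ℤ)| ≤ |x 0 k - x 1 k| := by
      have h := ZMod.natAbs_min_of_le_div_two (2 * L + 1) _ (x 0 k - x 1 k) (ZMod.coe_valMinAbs _)
        (ZMod.natAbs_valMinAbs_le _)
      rw [Int.abs_eq_natAbs, Int.abs_eq_natAbs]
      exact_mod_cast h
    have h2 : ((|x 0 k - x 1 k| : ℤ) : ℝ) ≤ ‖siteToE (x 0 - x 1)‖ := by
      have := abs_coord_le_norm_siteToE (x 0 - x 1) k
      simpa using this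
    have h3 : ‖z‖ = a * ‖siteToE (x 0 - x 1)‖ := by
      have : z = a • siteToE (x 0 - x 1) := by
        rw [hz_def, siteToE_sub, smul_sub]; rfl
      rw [this, norm_smul, Real.norm_eq_abs, abs_of_pos ha]
    have h4 : (2 * (R : ℝ) + 4) ≤ ‖siteToE (x 0 - x 1)‖ := by
      have : ((2 * (R : ℤ) + 4 : ℤ) : ℝ) ≤ ((|x 0 k - x 1 k| : ℤ) : ℝ) := by exact_mod_cast hk.trans h1
      push_cast at this h2
      linarith
    have haR : a * R ≤ 1 := by nlinarith
    have haR8 : (a * R) ^ 8 ≤ 1 := pow_le_one₀ (by positivity) haR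
    rw [abs_mul, abs_of_nonneg (by positivity : 0 ≤ a ^ 8), div_pow, ← pow_mul,
      le_div_iff₀ (by positivity)]
    have hh := hB z
    calc a ^ 8 * |h z| * (R : ℝ) ^ (4 * 2) = (a * R) ^ 8 * |h z| := by ring
      _ ≤ 1 * 4 := mul_le_mul haR8 hh (abs_nonneg _) zero_le_one
      _ ≤ 2 ^ 2 := by norm_num
  · rw [Wgen_of_ne_two h β L hn, abs_zero]; positivity

/-- The limit integrand of the cubic witness: `Ψ_s(w) = q(z) · q(z) χ_s(z) ψ(w₁)`, `z = w₀ − w₁`, `q = ∂_θ h_c`. -/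
def PsiFun (s : ℝ) (hs : 0 < s) (w : Fin 2 → E4) : ℝ := angDeriv hcFun (w 0 - w 1) * testFun qFun s hs w

/-- `Ψ_s = q² χ_s ψ` pointwise. -/
theorem PsiFun_eq (s : ℝ) (hs : 0 < s) (w : Fin 2 → E4) :
    PsiFun s hs w = qFun (w 0 - w 1) ^ 2 * chiFun s hs (w 0 - w 1) * psiFun (w 1) := by
  unfold PsiFun testFun
  rw [angDeriv_hcFun]
  ring

/-- `Ψ_s` is continuous. -/
theorem continuous_PsiFun (s : ℝ) (hs : 0 < s) : Continuous (PsiFun s hs) := by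
  have hz : Continuous fun w : Fin 2 → E4 => w 0 - w 1 := (continuous_apply 0).sub (continuous_apply 1)
  have e : PsiFun s hs = fun w => qFun (w 0 - w 1) ^ 2 * chiFun s hs (w 0 - w 1) * psiFun (w 1) := funext (PsiFun_eq s hs)
  rw [e]
  exact (((continuous_qFun.comp hz).pow 2).mul ((contDiff_bump_norm_sq (chiBump s hs)).continuous.comp hz)).mul
    (contDiff_psiFun.continuous.comp (continuous_apply 1))

/-- `Ψ_s` has compact support (`s ≤ 1`). -/
theorem hasCompactSupport_PsiFun (s : ℝ) (hs : 0 < s) (hs1 : s ≤ 1) : HasCompactSupport (PsiFun s hs) := by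
  refine HasCompactSupport.intro (isCompact_closedBall (0 : Fin 2 → E4) 4) fun w hw => ?_
  rw [mem_closedBall, dist_zero_right, not_le] at hw
  unfold PsiFun
  rw [testFun_eq_zero_of_norm hs1 hw, mul_zero]

/-- `Ψ_s ≥ 0`. -/
theorem PsiFun_nonneg (s : ℝ) (hs : 0 < s) (w : Fin 2 → E4) : 0 ≤ PsiFun s hs w := by
  rw [PsiFun_eq]
  exact mul_nonneg (mul_nonneg (sq_nonneg _) (chiBump s hs).nonneg) eta.nonneg

/-- `Ψ_s > 0` at the point `((3s/5) e₀ + (4s/5) e₁, 0)`. -/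
theorem PsiFun_pos (s : ℝ) (hs : 0 < s) (hs1 : s ≤ 1) :
    0 < PsiFun s hs (fun i => if i = 0 then WithLp.toLp 2 ![3 * s / 5, 4 * s / 5, 0, 0] else 0) := by
  set z : E4 := WithLp.toLp 2 ![3 * s / 5, 4 * s / 5, 0, 0] with hz
  have hz0 : z 0 = 3 * s / 5 := by simp [hz]
  have hz1 : z 1 = 4 * s / 5 := by simp [hz]
  have hnorm2 : ‖z‖ ^ 2 = s ^ 2 := by
    rw [EuclideanSpace.norm_sq_eq]
    simp [hz, Fin.sum_univ_four]
    ring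
  have hnorm : ‖z‖ = s := by
    have := (pow_left_inj₀ (norm_nonneg z) hs.le two_ne_zero).1 hnorm2
    exact this
  have hq : qFun z = 4 * (3 * s / 5) * (4 * s / 5) * ((4 * s / 5) ^ 2 - (3 * s / 5) ^ 2) := by
    unfold qFun
    rw [hnorm2, hz0, hz1, ContDiffBump.one_of_mem_closedBall]
    · ring
    · simp only [eta, mem_closedBall, dist_zero_right, Real.norm_eq_abs]
      rw [abs_of_nonneg (by positivity)]
      nlinarith
  have hdiff : (fun i : Fin 2 => if i = 0 then z else 0) 0 - (fun i : Fin 2 => if i = 0 then z else 0) 1 = z := by simp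
  rw [PsiFun_eq, hdiff, chiFun_eq_one hnorm, hq]
  simp only [Fin.one_eq_zero_iff, OfNat.ofNat_ne_one, if_false, psiFun_zero]
  have : 0 < s ^ 4 := by positivity
  nlinarith

/-- `∫ Ψ_s > 0`. -/
theorem integral_PsiFun_pos (s : ℝ) (hs : 0 < s) (hs1 : s ≤ 1) : 0 < ∫ w, PsiFun s hs w :=
  (continuous_PsiFun s hs).integral_pos_of_hasCompactSupport_nonneg_nonzero (hasCompactSupport_PsiFun s hs hs1)
    (PsiFun_nonneg s hs) (PsiFun_pos s hs hs1).ne'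

/-- **The angular insertion of the cubic witness converges to `∫Ψ_s > 0`** along `(a_k, L_k) = ((k+24)⁻¹, (k+24)²)`, at the germ-class
test function `T_{q,s}` (`q = ∂_θ h_c`): weight-side Taylor expansion (`abs_latAngMom_profile_sub_le`) + Riemann count + the tree's
`tendsto_riemann_sum`. -/
theorem tendsto_angularSum_Wgen_hcFun {s : ℝ} (hs : 0 < s) (hs1 : s ≤ 1) :
    Tendsto (fun k : ℕ => angularSum (Wgen hcFun k (LW k) 2) (LW k) (aW k) (TestS qFun contDiff_qFun s hs hs1)) atTop
      (𝓝 (((∫ w, PsiFun s hs w : ℝ)) : ℂ)) := by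
  classical
  have hhc : HasCompactSupport hcFun := by
    refine HasCompactSupport.intro (isCompact_closedBall (0 : E4) 2) fun z hz => ?_
    rw [mem_closedBall, dist_zero_right, not_le] at hz
    exact hcFun_eq_zero_of_norm hz.le
  obtain ⟨K, hK0, hK⟩ := exists_lipschitz_fderiv_real hcFun contDiff_hcFun hhc
  have hdiff : Differentiable ℝ hcFun := contDiff_hcFun.differentiable (by simp)
  obtain ⟨M, hM0, hM⟩ := eventually_card_scaled_le (n := 2) 4 (fun k : ℕ => aW k) LW (fun k => aW_pos _)
    tendsto_aW_nat tendsto_aW_mul_LW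
  set F := TestS qFun contDiff_qFun s hs hs1 with hF_def
  -- a uniform bound on the test function
  set B : ℝ := SchwartzMap.seminorm ℂ 0 0 F with hB_def
  have hB0 : 0 ≤ B := apply_nonneg _ _
  have hFB : ∀ w, ‖F w‖ ≤ B := fun w => SchwartzMap.norm_le_seminorm ℂ F w
  -- (1) the main term: a Riemann sum of `Ψ_s`
  have hmain : Tendsto (fun k : ℕ => ∑ x ∈ Fintype.piFinset (fun _ : Fin 2 => box 4 (LW k)),
      (((aW k ^ 8 * angDeriv hcFun (scaleSite (aW k) x 0 - scaleSite (aW k) x 1) : ℝ)) : ℂ) * F (scaleSite (aW k) x))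
      atTop (𝓝 (((∫ w, PsiFun s hs w : ℝ)) : ℂ)) := by
    have hR : Tendsto (fun k : ℕ => aW k ^ (4 * 2) *
        ∑ x ∈ Fintype.piFinset (fun _ : Fin 2 => box 4 (LW k)), PsiFun s hs (scaleSite (aW k) x)) atTop
        (𝓝 (∫ w, PsiFun s hs w)) :=
      Summit.QuantumFields.YangMills.Cruxes.OSLegsAtWeakCouplingC.Sketch.tendsto_riemann_sum (PsiFun s hs)
        (continuous_PsiFun s hs) (hasCompactSupport_PsiFun s hs hs1) (fun k : ℕ => aW k) LW (fun k => aW_pos _)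
        tendsto_aW_nat tendsto_aW_mul_LW
    have hR' := (Complex.continuous_ofReal.tendsto _).comp hR
    refine hR'.congr' (Eventually.of_forall fun k => ?_)
    simp only [Function.comp_apply]
    push_cast
    rw [Finset.mul_sum]
    refine Finset.sum_congr rfl fun x _ => ?_
    rw [hF_def, TestS_apply]
    simp only [PsiFun]
    push_cast
    ring
  -- (2) the Taylor remainder is `O(a_k)`
  have hrem : Tendsto (fun k : ℕ => ∑ x ∈ Fintype.piFinset (fun _ : Fin 2 => box 4 (LW k)),
      (((latAngMom (Wgen hcFun k (LW k) 2) x - aW k ^ 8 * angDeriv hcFun (scaleSite (aW k) x 0 - scaleSite (aW k) x 1) : ℝ)) : ℂ) *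
        F (scaleSite (aW k) x)) atTop (𝓝 0) := by
    have hev : ∀ᶠ k : ℕ in atTop, ‖∑ x ∈ Fintype.piFinset (fun _ : Fin 2 => box 4 (LW k)),
        (((latAngMom (Wgen hcFun k (LW k) 2) x - aW k ^ 8 * angDeriv hcFun (scaleSite (aW k) x 0 - scaleSite (aW k) x 1) : ℝ)) : ℂ) *
          F (scaleSite (aW k) x)‖ ≤ (16 * K * B * M) * aW k := by
      filter_upwards [hM] with k hkM
      have ha := aW_pos k
      set a := aW k with ha_def
      set S := Fintype.piFinset (fun _ : Fin 2 => box 4 (LW k)) with hS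
      have hW : Wgen hcFun k (LW k) 2 = fun x : Fin 2 → Site 4 => a ^ 8 * hcFun (scaleSite a x 0 - scaleSite a x 1) :=
        funext fun x => Wgen_two hcFun k (LW k) x
      have hpt : ∀ x ∈ S, ‖(((latAngMom (Wgen hcFun k (LW k) 2) x -
            a ^ 8 * angDeriv hcFun (scaleSite a x 0 - scaleSite a x 1) : ℝ)) : ℂ) * F (scaleSite a x)‖ ≤
          16 * K * a ^ 9 * B * (if ‖scaleSite a x‖ ≤ 4 + 1 then 1 else 0) := by
        intro x _
        by_cases hFx : F (scaleSite a x) = 0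
        · rw [hFx, mul_zero, norm_zero]
          split_ifs <;> positivity
        have hx4 : ‖scaleSite a x‖ ≤ 4 :=
          norm_le_of_mem_tsupport_TestS qFun contDiff_qFun s hs hs1 (subset_tsupport _ (Function.mem_support.2 hFx))
        have h45 : ‖scaleSite a x‖ ≤ 4 + 1 := by linarith
        rw [if_pos h45, mul_one, norm_mul, Complex.norm_real, Real.norm_eq_abs, hW]
        have h1 := abs_latAngMom_profile_sub_le hcFun hdiff hK0 hK ha x
        have h2 : a * ‖x‖ ≤ 4 := (mul_norm_le_norm_scaleSite ha.le x).trans hx4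
        have h3 : 4 * K * a ^ 10 * ‖x‖ ≤ 16 * K * a ^ 9 := by
          have : 4 * K * a ^ 10 * ‖x‖ = 4 * K * a ^ 9 * (a * ‖x‖) := by ring
          rw [this]
          have : 0 ≤ 4 * K * a ^ 9 := by positivity
          nlinarith
        exact mul_le_mul (h1.trans h3) (hFB _) (norm_nonneg _) (by positivity)
      have hkM' : a ^ 8 * ((S.filter (fun x => ‖scaleSite a x‖ ≤ 4 + 1)).card : ℝ) ≤ M := by
        have : a ^ (4 * 2) = a ^ 8 := by norm_num
        rw [← this]; exact hkM
      calc _ ≤ ∑ x ∈ S, 16 * K * a ^ 9 * B * (if ‖scaleSite a x‖ ≤ 4 + 1 then 1 else 0) :=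
            (norm_sum_le _ _).trans (Finset.sum_le_sum hpt)
        _ = 16 * K * B * a * (a ^ 8 * ((S.filter (fun x => ‖scaleSite a x‖ ≤ 4 + 1)).card : ℝ)) := by
            rw [← Finset.mul_sum, Finset.sum_boole]; ring
        _ ≤ 16 * K * B * a * M := by gcongr
        _ = (16 * K * B * M) * a := by ring
    refine squeeze_zero_norm' hev ?_
    simpa using tendsto_aW_nat.const_mul (16 * K * B * M)
  -- (3) assemble
  have hsum : ∀ k : ℕ, angularSum (Wgen hcFun k (LW k) 2) (LW k) (aW k) F =
      ∑ x ∈ Fintype.piFinset (fun _ : Fin 2 => box 4 (LW k)),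
        (((aW k ^ 8 * angDeriv hcFun (scaleSite (aW k) x 0 - scaleSite (aW k) x 1) : ℝ)) : ℂ) * F (scaleSite (aW k) x) +
      ∑ x ∈ Fintype.piFinset (fun _ : Fin 2 => box 4 (LW k)),
        (((latAngMom (Wgen hcFun k (LW k) 2) x -
          aW k ^ 8 * angDeriv hcFun (scaleSite (aW k) x 0 - scaleSite (aW k) x 1) : ℝ)) : ℂ) * F (scaleSite (aW k) x) := by
    intro k
    rw [angularSum, ← Finset.sum_add_distrib]
    refine Finset.sum_congr rfl fun x _ => ?_
    push_cast
    ring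
  have hlim := hmain.add hrem
  rw [add_zero] at hlim
  exact hlim.congr (fun k => (hsum k).symm)

/-- **The cubic witness violates the AngularWard shape.** -/
theorem not_angularWardShape_Wgen_hcFun : ¬ AngularWardShape aW (Wgen hcFun) := by
  intro h
  obtain ⟨r₀, hr₀, H⟩ := h (fun k => (k : ℝ)) LW tendsto_natCast_atTop_atTop ranges_W
  set s : ℝ := min (r₀ / 4) 1 with hs_def
  have hs : 0 < s := lt_min (by positivity) one_pos
  have hs1 : s ≤ 1 := min_le_right _ _
  have h2s : 2 * s < r₀ := by
    have := min_le_left (r₀ / 4) 1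
    linarith
  obtain ⟨hFo, hFc, hFδ, hFr⟩ := TestS_mem_kingClass qFun contDiff_qFun s hs hs1 h2s
  have h0 := H 2 le_rfl (TestS qFun contDiff_qFun s hs hs1) hFo hFc hFδ hFr
  have h1 := tendsto_angularSum_Wgen_hcFun hs hs1
  have heq := tendsto_nhds_unique h0 h1
  have hpos := integral_PsiFun_pos s hs hs1
  have : ((∫ w, PsiFun s hs w : ℝ) : ℂ) = 0 := heq.symm
  exact hpos.ne' (by exact_mod_cast this)

/-- **SHAPE BARRIER, hypercubic-invariant form.**  There is a unit map `a` and a weight family `W` with ALL the kinematic structure of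
the centred torus moments of `tr F²` that is visible to the binder — only the two-point weight non-zero, TRANSLATION invariant,
HYPERCUBIC invariant (axis permutations and reflections), exact hyperscaling size `|W| ≤ 4 a⁸` — satisfying EVERY MomentBounds-shape
inequality (`C = 2`) and violating the AngularWard shape.  Hence «defect ≤ ω(a)·(MomentBounds norms)», `ω → 0`, cannot be derived
from the binder's inequalities plus the lattice symmetries: the registered stub needs the dynamics. -/
theorem exists_hypercubic_momentBoundsShape_not_angularWardShape :
    ∃ (a : ℝ → ℝ) (W : ℝ → ℕ → (n : ℕ) → (Fin n → Site 4) → ℝ),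
      (∀ β, 0 < a β) ∧ Tendsto a atTop (𝓝 0) ∧
      (∀ β L n (x : Fin n → Site 4), n ≠ 2 → W β L n x = 0) ∧
      (∀ β L (x : Fin 2 → Site 4) (t : Site 4), W β L 2 (fun i => x i + t) = W β L 2 x) ∧
      (∀ β L (σ : Equiv.Perm (Fin 4)) (ε : Fin 4 → ℤ), (∀ μ, ε μ = 1 ∨ ε μ = -1) →
        ∀ x : Fin 2 → Site 4, W β L 2 (fun i μ => ε μ * x i (σ μ)) = W β L 2 x) ∧
      (∀ β L n (x : Fin n → Site 4), |W β L n x| ≤ 4 * a β ^ 8) ∧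
      MomentBoundsShape a W ∧ ¬ AngularWardShape a W :=
  ⟨aW, Wgen hcFun, aW_pos, tendsto_aW, fun β L _ x hn => Wgen_of_ne_two hcFun β L hn x, Wgen_translate hcFun,
    fun β L σ ε hε x => Wgen_hcFun_hypercubic β L σ ε hε x, fun β L _ x => abs_Wgen_le hcFun abs_hcFun_le β L x,
    momentBoundsShape_Wgen hcFun abs_hcFun_le (fun _ hz => hcFun_eq_zero_of_norm hz), not_angularWardShape_Wgen_hcFun⟩

end CubicWitness

end Summit.QuantumFields.YangMills.Theorems.ROT.Ward

end
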